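import Summits.ABC.IUTFork.Joshi.AdelicAnsatzDerived
import Summits.ABC.IUTFork.Joshi.Arithmeticoids
import HarnessLib

/-!
# [J-III] Thm. 4.2.2.1 (3) (diagonal reading) and Cor. 4.2.3.3 SUPPLIED at the `w`-level: E-t7's inputs
# `LStarThroughFrobenius` ([J-2½] Thm. 4.2.3 (4)) and `[MetrizableSpace 𝒴′_{L′}]` ([J-2½] Lem. 4.1.2) READ THROUGH
# E-t37's typed deformation datum `ATS2h.DeformationDatum` along a gluing certificate

Proof-only companion (abc-iut cell, block E «type Joshi's construction, test vs S», rung LADDER-ABC:A2.E; seat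
abc-iut-E-t57, batch-3 slot «[J-IIp] DERIVABLE/SUPPLIER seat», rows **S2** and **S3** named by the owner abc-iut-E-t7
2026-08-26T07:50:30Z) of `Joshi/AdelicAnsatz.lean` (E-t7, p428940) and `Joshi/AdelicAnsatzDerived.lean` (p429123), over
`Joshi/Arithmeticoids.lean` (E-t37, p430482). Sequel of `Joshi/AdelicAnsatzLocalSupply.lean` (this seat, p432358: the
`ℚ_p`-LEVEL rows S1 from E-t3's `PrototypeDatum`); this file glues the `w`-LEVEL. SOURCES: K. Joshi, arXiv:2401.13508v4 = [J-III]
(unrefereed; bib `Joshi2024ATS3`; render `HOME/lit/renders/Joshi-arxiv-2401.13508/pNNNN.txt`), §4.1–4.2 pp.30–34; arXiv:2305.10398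
= [J-2½] (unrefereed; bib `Joshi2023ATS2half`; render `HOME/plan/repair/lit/renders/Joshi-arxiv-2305.10398-ATS2half/`), Lem. 4.1.2
p.20 l.72–91, Thm. 4.2.3 (4) p.22 l.1–15 with proof p.23 l.43–72. TAKES NO SIDE on [IUTchIII] Cor. 3.12, on Joshi's claims or on
Mochizuki's report on them; typed ≠ proved ≠ endorsed. Object-side file (E-PLAN R14: imports Joshi object files only; no
`Cor312*` / `Thm311*` import). No FACT-LIST row is consumed; no new `Prop` is introduced; nothing is asserted.

WHAT IS TYPED AND PROVED.

* §1 `AdelicCurveDatum.DeformationSupply D 𝔇` — a gluing CERTIFICATE (data + equations, no asserted property) between E-t7's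
  adelic curve datum `D` ([J-III] §4.1: places `𝕍_{L′}`, factors `|Y_{C_p^♭,L′_w}|`, Frobenii `ϕ_w`, the abstract `L′*` with its
  power map and factorwise action) and a deformation datum `𝔇 : ATS2h.DeformationDatum L′ D.V L′_w D.Y …` of E-t37 ON THE SAME
  places and point types ([J-2½] §4: `ϕ_v : Y ≃ₜ Y`, the Lubin–Tate action `act v : L′ˣ →* (Y ≃ₜ Y)`, `ord_v`): `frob_eq`
  (the two Frobenii agree as bijections), `toUnits : D.Lstar → L′ˣ` with `lact_eq` (E-t7's factorwise `L′*`-action IS E-t37's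
  `act`), and `oddss_nonarch` ([J-III] §3.2 (6): `V^{odd,ss}` consists of finite places — so [J-2½] Thm. 4.2.3 (4), stated «for
  each non-archimedean `v`», applies there).
* §2 **S2**: `σ.lStarThroughFrobenius : 𝔇.LActsByFrobeniusPowers → D.LStarThroughFrobenius` — E-t7's input IS E-t37's typed
  [J-2½] Thm. 4.2.3 (4) `LActsByFrobeniusPowers` («`x` acts by `ϕ_v^{ord_v(x)}`») read along the certificate, with the exponent
  made explicit (`lact_eq_frob_zpow`: `n = ord_w(x)`); the transport of integer powers from `Y ≃ₜ Y` to `Equiv.Perm Y` is the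
  monoid morphism `Homeomorph.toPermHom` (§0). Whence E-t7's **Thm. 4.2.2.1 (3) in the DIAGONAL reading**
  (`ansatzLStarStableDiag_of`) modulo `LActsByFrobeniusPowers` and the [J-IIp] input `PrimAnsatzFrobeniusInvariant` only — the
  latter is supplied at the `ℚ_p`-level by `AdelicCurveDatum.PrototypeSupply.primAnsatzFrobeniusInvariant` (p432358), so that
  along BOTH certificates (3)-diagonal rests on E-t37's Thm. 4.2.3 (4) claim alone. `LActsByFrobeniusPowers` itself is a
  Lubin–Tate / [FF18, Prop. 2.3.9] statement that no block-E carrier constructs: it stays a claim-`Prop` BY NAME (E-t7: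
  «discharged AT AN INSTANTIATION, never globally»).
* §3 **S3**: `curve_metrizableSpace 𝔇 : MetrizableSpace D.Curve` — the instance-hypothesis of E-t7's `ansatzMetrisable_of`
  (Cor. 4.2.3.3) from E-t37's fields `countable_V` («`V_L` is countable», Lem. 4.1.2 proof p.20 l.74) and `metrizable` ([FF18,
  Prop. 2.3.2], p.20 l.79–89) via E-t7's `curve_metrizable_of_countable` (= E-t37's `ycal_metrizable` on the nose, `Ycal 𝔇 =
  D.Curve` definitionally: `curve_metrizableSpace_eq`); whence `ansatzMetrisable` ([J-III] Cor. 4.2.3.3 «`Σ̃_{L′}` is a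
  metrisable space») and `thetaGauLink_metrizable` (Rmk. 4.2.3.4) with NO instance hypothesis left. No certificate is needed
  for S3: only that `𝔇` lives on `D`'s places and point types.
* §4 RELATIVE SATISFIABILITY of §1: for ANY deformation datum `𝔇` and any choice of `ℓ⋆`, `V^{odd,ss} ⊆ V^non`, `ℚ_p`-level
  data and Galois data, the adelic curve datum `ATS2h.DeformationDatum.toAdelicCurveDatum 𝔇 Λ` whose Frobenii and `L′*`-action ARE `𝔇`'s carries a
  certificate (all equations `rfl`) — §1 asks nothing beyond E-t37's signature. An inhabited `DeformationDatum` is E-t37's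
  `Joshi/ArithmeticoidsToyModel.lean` (p432522, not imported here).

REGISTRY GRAMMAR (abc-iut-E-dag): «E SUPPLY J3:Thm4.2.2.1(3)-diag / LStarThroughFrobenius: REDUCED to J2h:Thm4.2.3(4)
(`ATS2h.DeformationDatum.LActsByFrobeniusPowers`, E-t37 p430482) along `DeformationSupply`; J3:Cor4.2.3.3 / [MetrizableSpace]:
SUPPLIED from J2h:Lem4.1.2 fields (`countable_V`, `metrizable`); no located residual». Deliberately NOT here: the Galois rows
(E-t7's `gact`/`res`/`forget_gal` vs E-t37's `gal` — Thm. 4.2.2.1 (1) needs only the `ℚ_p`-level, supplied in p432358), the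
`ℚ_p`-level (p432358), any judgement.
-/

noncomputable section

open TopologicalSpace

/-! ## 0. Transport of integer powers from homeomorphisms to permutations -/

namespace Homeomorph

variable {X : Type*} [TopologicalSpace X]

/-- The forgetful MONOID MORPHISM `(X ≃ₜ X) →* Equiv.Perm X`, `h ↦ h.toEquiv` (both groups multiply by `g.trans f`;
definitional). Dot-notation extension of Mathlib's `Homeomorph` namespace, declared deliberately (used to move `ϕ_v^n`,
`n ∈ ℤ`, between E-t37's homeomorphisms and E-t7's bijections). [folklore] -/
def toPermHom : (X ≃ₜ X) →* Equiv.Perm X where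
  toFun h := h.toEquiv
  map_one' := rfl
  map_mul' _ _ := rfl

/-- `toPermHom h = h.toEquiv`. [folklore] -/
@[simp] theorem toPermHom_apply (h : X ≃ₜ X) : toPermHom h = h.toEquiv := rfl

/-- Integer powers commute with forgetting the topology: `(h ^ n).toEquiv = h.toEquiv ^ n`, `n ∈ ℤ`. [folklore] -/
theorem toEquiv_zpow (h : X ≃ₜ X) (n : ℤ) : (h ^ n).toEquiv = h.toEquiv ^ n :=
  map_zpow toPermHom h n

/-- Pointwise form: `(h ^ n) x = (h.toEquiv ^ n) x`, `n ∈ ℤ`. [folklore] -/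
theorem zpow_apply_eq_toEquiv_zpow (h : X ≃ₜ X) (n : ℤ) (x : X) : (h ^ n) x = (h.toEquiv ^ n) x := by
  rw [← toEquiv_zpow]; rfl

end Homeomorph

namespace Summit.ABC.IUTFork.Joshi

namespace AdelicCurveDatum

variable (D : AdelicCurveDatum)

/-! ## 1. The gluing certificate at the `w`-level: `D`'s places, factors, Frobenii and `L′*`-action are a deformation datum -/

/-- **`DeformationSupply D 𝔇`** — a gluing CERTIFICATE (data and equations; NO property of [J-III] or [J-2½] is asserted)
between E-t7's adelic curve datum `D` ([J-III] §4.1 p.30 l.20–48, §4.2 p.31 l.2–17: «the three actions `G_{L′} ↷ 𝒴_{L′}`,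
`L′* ↷ 𝒴_{L′}`, `ϕ ↷ 𝒴_{L′}` of [Joshi, 2023a, Theorem 4.2.3]») and a deformation datum `𝔇` of E-t37 ([J-2½] §4–§5) for the
field `L′` ON `D`'s places `D.V` and factors `D.Y w = |Y_{C_p^♭,L′_w}|`: the Frobenii agree (`frob_eq`; E-t7 models `ϕ_w` as a
bijection, E-t37 as a homeomorphism), E-t7's abstract `L′*` maps to `L′ˣ` (`toUnits`) compatibly with the factorwise action
(`lact_eq`: «via the diagonal embedding `x ↦ (x)_w`», [J-2½] proof p.23 l.26–32), and the bad places are finite places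
(`oddss_nonarch`: [J-III] §3.2 (6) `V^{odd,ss}_{L′}` = odd places of bad semi-stable reduction). The remaining fields of either
signature (Galois data, `ℚ_p`-level, residue fields, `α_y`, product formula) are not related here. [claim: Joshi2024ATS3, status: disputed] -/
structure DeformationSupply {L : Type} [Field L] {Lv : D.V → Type} [∀ w, Field (Lv w)] [∀ w, TopologicalSpace (D.Y w)]
    {K : (w : D.V) → D.Y w → Type} [∀ w y, Field (K w y)] [∀ w y, TopologicalSpace (K w y)]
    {G : D.V → Type} [∀ w, Group (G w)] {A : D.V → Type} [∀ w, Group (A w)]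
    (𝔇 : ATS2h.DeformationDatum L D.V Lv D.Y K G A) : Type where
  /-- `V^{odd,ss}_{L′} ⊆ V^non_{L′}` ([J-III] §3.2 (6)) -/
  oddss_nonarch : ∀ w, w ∈ D.oddss → w ∉ 𝔇.Varc
  /-- the Frobenius `ϕ_w` of `D` IS `𝔇`'s `ϕ_w` (as a bijection of `|Y_{C_p^♭,L′_w}|`) -/
  frob_eq : ∀ w, D.frob w = (𝔇.frob w).toEquiv
  /-- E-t7's abstract carrier `L′*` read in `L′ˣ` -/
  toUnits : D.Lstar → Lˣ
  /-- the factorwise `L′*`-action of `D` IS `𝔇`'s local action `act w` ([J-2½] Thm. 4.2.3 (3), proof p.23 l.26–32) -/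
  lact_eq : ∀ (x : D.Lstar) (w : D.V) (y : D.Y w), D.lact x w y = 𝔇.act w (toUnits x) y

namespace DeformationSupply

variable {D}
variable {L : Type} [Field L] {Lv : D.V → Type} [∀ w, Field (Lv w)] [∀ w, TopologicalSpace (D.Y w)]
  {K : (w : D.V) → D.Y w → Type} [∀ w y, Field (K w y)] [∀ w y, TopologicalSpace (K w y)]
  {G : D.V → Type} [∀ w, Group (G w)] {A : D.V → Type} [∀ w, Group (A w)]
  {𝔇 : ATS2h.DeformationDatum L D.V Lv D.Y K G A} (σ : D.DeformationSupply 𝔇)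

include σ

/-! ## 2. S2: `LStarThroughFrobenius` is [J-2½] Thm. 4.2.3 (4) read along the certificate -/

/-- Along a certificate, under E-t37's typed [J-2½] Thm. 4.2.3 (4) `LActsByFrobeniusPowers` («for each non-archimedean `v`, the
`L*` action on each factor is through powers of the Frobenius `ϕ_v`», p.22 l.1–15; exponent `ord_v(x)` from the proof p.23
l.43–72): at a bad place `w`, `x ∈ L′*` acts on `|Y_{C_p^♭,L′_w}|` by `ϕ_w^{ord_w(x)}` IN E-t7's VOCABULARY (integer power of the
bijection `D.frob w`). [claim: Joshi2023ATS2half, status: disputed] -/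
theorem lact_eq_frob_zpow (h : 𝔇.LActsByFrobeniusPowers) {w : D.V} (hw : w ∈ D.oddss) (x : D.Lstar) (y : D.Y w) :
    D.lact x w y = (D.frob w ^ Multiplicative.toAdd (𝔇.ord w (σ.toUnits x))) y := by
  rw [σ.lact_eq, h w (σ.oddss_nonarch w hw) (σ.toUnits x), σ.frob_eq, Homeomorph.zpow_apply_eq_toEquiv_zpow]

/-- **S2 — INPUT [J-2½] Thm. 4.2.3 (4) SUPPLIED along the certificate**: E-t7's `LStarThroughFrobenius` («at each
`w ∈ V^{odd,ss}` every `x ∈ L′*` acts through an integer power of `ϕ_w`») follows from E-t37's typed claim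
`ATS2h.DeformationDatum.LActsByFrobeniusPowers`, with witness `n = ord_w(x)`. The claim itself (Lubin–Tate: «any uniformizer
operates by Frobenius … `𝒪*_{L_v}` acts trivially», [FF18, Prop. 2.3.9]) stays a hypothesis BY NAME. [claim: Joshi2023ATS2half,
status: disputed] -/
theorem lStarThroughFrobenius (h : 𝔇.LActsByFrobeniusPowers) : D.LStarThroughFrobenius :=
  fun w hw x => ⟨Multiplicative.toAdd (𝔇.ord w (σ.toUnits x)), fun y => σ.lact_eq_frob_zpow h hw x y⟩

/-- **[J-III] Thm. 4.2.2.1 (3) in the DIAGONAL reading along the certificate** (p.33 l.1–2 «Hence `Σ̃_{L′}` is also stable under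
the natural action of `(L′)*` on `𝒴_{L′}`»): E-t7's `ansatzLStarStableDiag_of`, its [J-2½] input supplied by S2; the [J-IIp]
input `PrimAnsatzFrobeniusInvariant` (Prop. 6.6.1 in `↔` form) remains a binder here and is supplied at the `ℚ_p`-level by
`AdelicCurveDatum.PrototypeSupply.primAnsatzFrobeniusInvariant` (`Joshi/AdelicAnsatzLocalSupply.lean`, p432358).
[claim: Joshi2024ATS3, status: disputed] -/
theorem ansatzLStarStableDiag (h : 𝔇.LActsByFrobeniusPowers) (hF : D.PrimAnsatzFrobeniusInvariant) :
    D.AnsatzLStarStableDiag :=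
  D.ansatzLStarStableDiag_of (σ.lStarThroughFrobenius h) hF

/-- Along the certificate, off the archimedean places E-t7's Frobenius `D.frob w` is `𝔇`'s `ϕ_w`, and AT an archimedean place it
is the identity ([J-2½] §4.5 p.26 l.64 «one takes `ϕ_v = 1`», E-t37's field `frob_arch`) — so E-t7's diagonal Frobenius
`frobTuple` fixes the archimedean coordinates. [claim: Joshi2023ATS2half, status: disputed] -/
theorem frob_apply_arch {w : D.V} (hw : w ∈ 𝔇.Varc) (y : D.Y w) : D.frob w y = y := by
  rw [σ.frob_eq, 𝔇.frob_arch w hw]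
  rfl

end DeformationSupply

/-! ## 3. S3: metrisability of `𝒴′_{L′}`, of `Σ̃_{L′}` (Cor. 4.2.3.3) and of the space of `Θgau`-Links (Rmk. 4.2.3.4) -/

section Metrisable

variable {D}
variable {L : Type} [Field L] {Lv : D.V → Type} [∀ w, Field (Lv w)] [∀ w, TopologicalSpace (D.Y w)]
  {K : (w : D.V) → D.Y w → Type} [∀ w y, Field (K w y)] [∀ w y, TopologicalSpace (K w y)]
  {G : D.V → Type} [∀ w, Group (G w)] {A : D.V → Type} [∀ w, Group (A w)]
  (𝔇 : ATS2h.DeformationDatum L D.V Lv D.Y K G A)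

include 𝔇

/-- **S3 — the instance-hypothesis `[MetrizableSpace 𝒴′_{L′}]` of E-t7's Cor. 4.2.3.3 SUPPLIED** from E-t37's fields:
«`V_L` is countable» (`countable_V`, [J-2½] Lem. 4.1.2 proof p.20 l.74) and «each `|Y_{F_v,L_v}|` is metrisable» (`metrizable`,
[FF18, Prop. 2.3.2] as used p.20 l.79–89), via E-t7's `curve_metrizable_of_countable` (Mathlib `PiCountable.metricSpace`).
[claim: Joshi2023ATS2half, status: disputed] -/
theorem curve_metrizableSpace : MetrizableSpace D.Curve := by
  haveI : Countable D.V := 𝔇.countable_V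
  haveI : ∀ w, MetrizableSpace (D.Y w) := 𝔇.metrizable
  exact D.curve_metrizable_of_countable

/-- The same instance is E-t37's [J-2½] Lem. 4.1.2 / Thm. 5.1.5 `ycal_metrizable` ON THE NOSE: `𝒴_{L′}` of E-t37 (`Ycal 𝔇 =
∀ v, Y v`) IS E-t7's `Curve` when `𝔇` lives on `D`'s places and factors. [claim: Joshi2023ATS2half, status: disputed] -/
theorem curve_metrizableSpace_eq : (curve_metrizableSpace 𝔇 : MetrizableSpace D.Curve) = 𝔇.ycal_metrizable := rfl

/-- **[J-III] Cor. 4.2.3.3 with NO instance hypothesis left** (p.34 l.50–52 «Mochizuki's Adelic Ansatz `Σ̃_{L′}` is a metrisable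
space with the topology and the metric induced from `𝒴^{ℓ*}_{L′}`»): E-t7's `ansatzMetrisable_of` fed by S3.
[claim: Joshi2024ATS3, status: disputed] -/
theorem ansatzMetrisable : D.AnsatzMetrisable := by
  haveI : MetrizableSpace D.Curve := curve_metrizableSpace 𝔇
  exact D.ansatzMetrisable_of

/-- **[J-III] Rmk. 4.2.3.4 with NO instance hypothesis left** (p.34 l.55–56 «it makes sense to talk about the distance between two
distinct `Θgau`-Links»): E-t7's `thetaGauLink_metrizable` fed by S3. [claim: Joshi2024ATS3, status: disputed] -/
theorem thetaGauLink_metrizableSpace :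
    @MetrizableSpace D.ThetaGauLink (TopologicalSpace.induced D.thetaGauLinkEquiv inferInstance) := by
  haveI : MetrizableSpace D.Curve := curve_metrizableSpace 𝔇
  exact D.thetaGauLink_metrizable

end Metrisable

end AdelicCurveDatum

/-! ## 4. Relative satisfiability of the certificate: the adelic curve datum OF a deformation datum -/

namespace ATS2h.DeformationDatum

variable {L : Type} [Field L] {V : Type} {Lv : V → Type} [∀ v, Field (Lv v)] {Y : V → Type}
  [∀ v, TopologicalSpace (Y v)] {K : (v : V) → Y v → Type} [∀ v y, Field (K v y)] [∀ v y, TopologicalSpace (K v y)]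
  {G : V → Type} [∀ v, Group (G v)] {A : V → Type} [∀ v, Group (A v)]
  (𝔇 : ATS2h.DeformationDatum L V Lv Y K G A)

/-- **The `ℚ_p`-level and bookkeeping data that [J-III] §4.1–4.2 adds to a deformation datum** (HYPOTHESIS structure, nothing
asserted): `ℓ⋆ ≥ 1`, the bad places `V^{odd,ss} ⊆ V^non`, the residue characteristics, the forgetful map (4.2.1.2) to
`|Y_{C_p^♭,ℚ_p}|` with its Galois/Frobenius equivariance and valuation compatibility, the restriction `G_w → G_{ℚ_p}`-level, the
common evaluation domains, and the primitive Ansatz (4.2.1.5) — exactly E-t7's `AdelicCurveDatum` fields that are NOT in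
[J-2½]. [claim: Joshi2024ATS3, status: disputed] -/
structure AnsatzLevel : Type 1 where
  /-- `V^{odd,ss}_{L′}` -/
  oddss : Set V
  /-- bad places are finite places -/
  oddss_nonarch : ∀ w, w ∈ oddss → w ∉ 𝔇.Varc
  /-- `ℓ⋆` -/
  lstar : ℕ
  /-- `ℓ⋆ ≥ 1` -/
  one_le_lstar : 1 ≤ lstar
  /-- the residue characteristics (including `∞`) -/
  P : Type
  /-- `w ↦ p_w` -/
  pOf : V → P
  /-- `|Y_{C_p^♭,ℚ_p}|` -/
  Y0 : P → Type
  /-- the forgetful map (4.2.1.2) -/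
  forget : (w : V) → Y w → Y0 (pOf w)
  /-- `G_{ℚ_p}`-level groups -/
  G0 : P → Type
  /-- their action -/
  g0act : (p : P) → G0 p → Y0 p → Y0 p
  /-- restriction `G_w → G_{ℚ_{p_w}}` -/
  res : (w : V) → G w → G0 (pOf w)
  /-- Galois equivariance of the forgetful map, `G_w` acting through `𝔇.gal` -/
  forget_gal : ∀ (w : V) (g : G w) (y : Y w), forget w (𝔇.gal w g y) = g0act (pOf w) (res w g) (forget w y)
  /-- Frobenius of `|Y_{C_p^♭,ℚ_p}|` -/
  frob0 : (p : P) → Y0 p ≃ Y0 p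
  /-- the forgetful map commutes with Frobenius, `ϕ_w = 𝔇.frob w` -/
  forget_frob : ∀ (w : V) (y : Y w), forget w (𝔇.frob w y) = frob0 (pOf w) (forget w y)
  /-- common evaluation domains -/
  T : P → Type
  /-- residue valuations of `D` on them -/
  absK : (w : V) → Y w → T (pOf w) → ℝ
  /-- at the `ℚ_p`-level -/
  absK0 : (p : P) → Y0 p → T p → ℝ
  /-- compatibility ([FF18 Prop. 2.3.20 (3)]) -/
  forget_abs : ∀ (w : V) (y : Y w), absK w y = absK0 (pOf w) (forget w y)
  /-- Mochizuki's primitive Ansatz (4.2.1.5) -/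
  primAnsatz : (p : P) → Set (Fin lstar → Y0 p)

/-- **The adelic curve datum OF a deformation datum** ([J-III] §4.1 «`𝒴′_{L′}` … with the three actions of [Joshi, 2023a,
Thm. 4.2.3]»): places, factors, Frobenii (`(𝔇.frob w).toEquiv`), Galois action (`𝔇.gal`) and `L′*`-action (`L′ˣ` with `x ↦ xⁿ`
and `𝔇.act`) FROM `𝔇`; the `ℚ_p`-level from an `AnsatzLevel`. The action law `lact_lpow` holds because `𝔇.act w` is a monoid
morphism. `@[reducible]` so that the topologies of the factors `Y w` are found through the projection `.Y`.
[claim: Joshi2024ATS3, status: disputed] -/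
@[reducible] def toAdelicCurveDatum (Λ : 𝔇.AnsatzLevel) : AdelicCurveDatum where
  V := V
  oddss := Λ.oddss
  P := Λ.P
  pOf := Λ.pOf
  Y := Y
  Y0 := Λ.Y0
  forget := Λ.forget
  lstar := Λ.lstar
  one_le_lstar := Λ.one_le_lstar
  G := G
  gact w g y := 𝔇.gal w g y
  G0 := Λ.G0
  g0act := Λ.g0act
  res := Λ.res
  forget_gal := Λ.forget_gal
  frob w := (𝔇.frob w).toEquiv
  frob0 := Λ.frob0
  forget_frob := Λ.forget_frob
  Lstar := Lˣ
  lpow x n := x ^ n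
  lact x w y := 𝔇.act w x y
  lact_lpow x n w y := by
    show (𝔇.act w (x ^ n)) y = (fun y => 𝔇.act w x y)^[n] y
    rw [map_pow]
    induction n generalizing y with
    | zero => rfl
    | succ n ih => rw [pow_succ, Homeomorph.mul_apply, ih, ← Function.iterate_succ_apply]
  T := Λ.T
  absK := Λ.absK
  absK0 := Λ.absK0
  forget_abs := Λ.forget_abs
  primAnsatz := Λ.primAnsatz

/-- **The certificate of §1 is satisfiable relative to E-t37's signature**: the adelic curve datum of `𝔇` carries a
`DeformationSupply` over `𝔇` (Frobenius and action equations `rfl`, `toUnits := id`). [claim: Joshi2024ATS3, status: disputed] -/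
def supply (Λ : 𝔇.AnsatzLevel) : (𝔇.toAdelicCurveDatum Λ).DeformationSupply 𝔇 where
  oddss_nonarch := Λ.oddss_nonarch
  frob_eq _ := rfl
  toUnits x := x
  lact_eq _ _ _ := rfl

/-- Hence, for the adelic curve datum of any deformation datum, E-t7's `LStarThroughFrobenius` IS E-t37's [J-2½] Thm. 4.2.3 (4)
claim and Cor. 4.2.3.3 holds outright. [claim: Joshi2024ATS3, status: disputed] -/
theorem toAdelicCurveDatum_lStarThroughFrobenius (Λ : 𝔇.AnsatzLevel) (h : 𝔇.LActsByFrobeniusPowers) :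
    (𝔇.toAdelicCurveDatum Λ).LStarThroughFrobenius ∧ (𝔇.toAdelicCurveDatum Λ).AnsatzMetrisable :=
  ⟨(𝔇.supply Λ).lStarThroughFrobenius h, AdelicCurveDatum.ansatzMetrisable (D := 𝔇.toAdelicCurveDatum Λ) 𝔇⟩

end ATS2h.DeformationDatum

end Summit.ABC.IUTFork.Joshi

end
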